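/-
Copyright (c) 2026. Released under Apache 2.0 license.
-/
import Literature.NumberTheory.Automorphic.UnboundedDenominatorsInvariantHomPrimePow
import HarnessLib

/-!
# The invariant form of CDT Cor. 4.5.3 at `2`-power depth: the top layer

`2`-adic analogue of `UnboundedDenominatorsInvariantHomLayerCentral` for the layer `Γ(M)/Γ(2M) ≅ 𝔰𝔩₂(𝔽₂)`
(`M` even).  For an `SL₂(ℤ)`-conjugation-invariant `θ : Γ(2M) → Q`:

* `map_commutatorElement_top_eq_one_of_two` — if `θ` kills the single commutator
  `ω₀ = [T^M, S T^M S⁻¹]`, then `θ` kills all of `[Γ(M), Γ(M)]` (the image of the top layer in `SL₂(ℤ)/K_θ`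
  is abelian): the coinvariants of `Λ²𝔰𝔩₂(𝔽₂)` under `SL₂(𝔽₂)` are spanned by `E ∧ F`;
* `map_omega_eq_one_of_four_dvd` — if `4 ∣ M`, `θ` does kill `ω₀` (`T^M` is the square of `T^{M/2}` and
  `[A², f] = [A, f²]` for a central `[A, f]`).

For `M ≡ 2 (mod 4)` the class of `ω₀` is Beyl's `ℤ/2` ([Beyl1986]) and need not die.
[cite: CalegariDimitrovTang2025, Corollary 4.5.3] [cite: Beyl1986, Theorem]
-/

open scoped MatrixGroups commutatorElement

namespace Literature.NumberTheory.Automorphic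

namespace UnboundedDenominators

open CongruenceSubgroup Matrix.SpecialLinearGroup ModularGroup

variable {Q : Type*} [CommGroup Q]

/-- `Γ(L) ≤ Γ(M)` for `M ∣ L`. [folklore] -/
private theorem Gamma_le_Gamma_of_dvd₁₃ {M L : ℕ} (h : M ∣ L) : Gamma L ≤ Gamma M := by
  intro γ hγ
  obtain ⟨h00, h01, h10, h11⟩ := Gamma_mem.mp hγ
  have cast_eq : ∀ a : ℤ, ((a : ZMod L).cast : ZMod M) = (a : ZMod M) := fun a ↦
    ZMod.cast_intCast h a
  rw [Gamma_mem]
  refine ⟨?_, ?_, ?_, ?_⟩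
  · rw [← cast_eq, h00, ZMod.cast_one h]
  · rw [← cast_eq, h01, ZMod.cast_zero]
  · rw [← cast_eq, h10, ZMod.cast_zero]
  · rw [← cast_eq, h11, ZMod.cast_one h]

/-- `T^M ∈ Γ(M)`. [folklore] -/
private theorem T_pow_mem_Gamma₃ (M : ℕ) : T ^ M ∈ Gamma M := by
  have := ModularGroup_T_pow_mem_Gamma (M : ℤ) (M : ℤ) (dvd_refl _)
  rwa [zpow_natCast, Int.natAbs_natCast] at this

/-- `[Γ(M), Γ(M)] ⊆ Γ(2M)` for even `M`. [folklore] [cite: CalegariDimitrovTang2025, §4.5] -/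
theorem commutatorElement_mem_Gamma_two_mul {M : ℕ} (hM2 : 2 ∣ M) {x y : SL(2, ℤ)} (hx : x ∈ Gamma M)
    (hy : y ∈ Gamma M) : ⁅x, y⁆ ∈ Gamma (M * 2) :=
  Gamma_le_Gamma_of_dvd₁₃ (mul_dvd_mul_left M hM2) (commutatorElement_mem_Gamma_mul_of_mem hx hy)

/-- **The top `2`-adic layer is abelian modulo `K_θ` once `θ` kills `ω₀ = [T^M, S T^M S⁻¹]`** (`M` even).
[cite: CalegariDimitrovTang2025, Corollary 4.5.3] [cite: Beyl1986, Theorem] -/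
theorem map_commutatorElement_top_eq_one_of_two {M : ℕ} (hM : M ≠ 0) (hM2 : 2 ∣ M)
    (θ : Gamma (M * 2) →* Q)
    (hθ : ∀ (g x : SL(2, ℤ)) (hx : x ∈ Gamma (M * 2)) (hgx : g * x * g⁻¹ ∈ Gamma (M * 2)),
      θ ⟨g * x * g⁻¹, hgx⟩ = θ ⟨x, hx⟩)
    (hω : θ ⟨⁅T ^ M, S * T ^ M * S⁻¹⁆, commutatorElement_mem_Gamma_two_mul hM2 (T_pow_mem_Gamma₃ M)
      ((Gamma_normal M).conj_mem _ (T_pow_mem_Gamma₃ M) S)⟩ = 1)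
    {x y : SL(2, ℤ)} (hx : x ∈ Gamma M) (hy : y ∈ Gamma M) (hxy : ⁅x, y⁆ ∈ Gamma (M * 2)) :
    θ ⟨⁅x, y⁆, hxy⟩ = 1 := by
  classical
  haveI := ker_map_subtype_normal θ hθ
  haveI := Gamma_normal (M * 2)
  haveI := Gamma_normal M
  set K : Subgroup SL(2, ℤ) := θ.ker.map (Gamma (M * 2)).subtype with hKdef
  set π : SL(2, ℤ) →* SL(2, ℤ) ⧸ K := QuotientGroup.mk' K with hπ
  have hNA : Gamma (M * 2) ≤ Gamma M := Gamma_le_Gamma_of_dvd₁₃ (dvd_mul_right M 2)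
  have hcommN : ∀ {u v : SL(2, ℤ)}, u ∈ Gamma M → v ∈ Gamma M → ⁅u, v⁆ ∈ Gamma (M * 2) :=
    fun {u v} hu hv ↦ commutatorElement_mem_Gamma_two_mul hM2 hu hv
  have hπone : ∀ (w : SL(2, ℤ)) (hw : w ∈ Gamma (M * 2)), π w = 1 → θ ⟨w, hw⟩ = 1 := by
    intro w hw h1
    rw [hπ, QuotientGroup.mk'_apply, QuotientGroup.eq_one_iff] at h1
    obtain ⟨_, h⟩ := (mem_ker_map_subtype_iff θ).mp h1
    exact h
  have hπone' : ∀ (w : SL(2, ℤ)) (hw : w ∈ Gamma (M * 2)), θ ⟨w, hw⟩ = 1 → π w = 1 := by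
    intro w hw h
    rw [hπ, QuotientGroup.mk'_apply, QuotientGroup.eq_one_iff]
    exact (mem_ker_map_subtype_iff θ).mpr ⟨hw, h⟩
  have hcentralN : ∀ w ∈ Gamma (M * 2), ∀ g : SL(2, ℤ) ⧸ K, ⁅g, π w⁆ = 1 ∧ ⁅π w, g⁆ = 1 := by
    intro w hw g
    have hc' : π w ∈ Subgroup.center (SL(2, ℤ) ⧸ K) := mk_mem_center_of_mem_Gamma θ hθ hw
    have hc := Subgroup.mem_center_iff.mp hc'
    constructor
    · rw [commutatorElement_def, hc g]; group
    · rw [commutatorElement_def, ← hc g]; group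
  have hcent : ∀ {u v : SL(2, ℤ)}, u ∈ Gamma M → v ∈ Gamma M →
      ⁅π u, π v⁆ ∈ Subgroup.center (SL(2, ℤ) ⧸ K) := fun {u v} hu hv ↦ by
    rw [← map_commutatorElement]
    exact (mk_mem_center_of_mem_Gamma θ hθ (hcommN hu hv) : π ⁅u, v⁆ ∈ Subgroup.center (SL(2, ℤ) ⧸ K))
  -- both-sided multiplicativity of `(u, v) ↦ [π u, π v]` on `Γ(M) × Γ(M)`
  have hRmul : ∀ {u v v' : SL(2, ℤ)}, u ∈ Gamma M → v ∈ Gamma M → v' ∈ Gamma M →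
      ⁅π u, π (v * v')⁆ = ⁅π u, π v⁆ * ⁅π u, π v'⁆ := by
    intro u v v' hu hv hv'
    have hc := Subgroup.mem_center_iff.mp (hcent hu hv')
    rw [map_mul, show ⁅π u, π v * π v'⁆ = ⁅π u, π v⁆ * (π v * ⁅π u, π v'⁆ * (π v)⁻¹) by
      simp only [commutatorElement_def]; group, hc (π v), mul_inv_cancel_right]
  have hLmul : ∀ {u u' v : SL(2, ℤ)}, u ∈ Gamma M → u' ∈ Gamma M → v ∈ Gamma M →
      ⁅π (u * u'), π v⁆ = ⁅π u, π v⁆ * ⁅π u', π v⁆ := by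
    intro u u' v hu hu' hv
    have hc := Subgroup.mem_center_iff.mp (hcent hu' hv)
    have hc' := Subgroup.mem_center_iff.mp (hcent hu hv)
    rw [map_mul, show ⁅π u * π u', π v⁆ = π u * ⁅π u', π v⁆ * (π u)⁻¹ * ⁅π u, π v⁆ by
      simp only [commutatorElement_def]; group, hc (π u), mul_inv_cancel_right]
    exact hc' _
  have hRzpow : ∀ {u v : SL(2, ℤ)}, u ∈ Gamma M → v ∈ Gamma M →
      ∀ k : ℤ, ⁅π u, π (v ^ k)⁆ = ⁅π u, π v⁆ ^ k := by
    intro u v hu hv k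
    have hR : ∀ l : ℕ, ⁅π u, π (v ^ l)⁆ = ⁅π u, π v⁆ ^ l := by
      intro l
      induction l with
      | zero => simp
      | succ l ih => rw [pow_succ, hRmul hu (pow_mem hv l) hv, ih, pow_succ]
    rcases Int.eq_nat_or_neg k with ⟨l, rfl | rfl⟩
    · rw [zpow_natCast, zpow_natCast, hR]
    · rw [zpow_neg, zpow_natCast, zpow_neg, zpow_natCast, ← hR]
      have h1 := hRmul hu (inv_mem (pow_mem hv l)) (pow_mem hv l)
      rw [inv_mul_cancel, map_one, commutatorElement_one_right] at h1
      exact eq_inv_of_mul_eq_one_left h1.symm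
  have hLzpow : ∀ {u v : SL(2, ℤ)}, u ∈ Gamma M → v ∈ Gamma M →
      ∀ k : ℤ, ⁅π (u ^ k), π v⁆ = ⁅π u, π v⁆ ^ k := by
    intro u v hu hv k
    have hL : ∀ l : ℕ, ⁅π (u ^ l), π v⁆ = ⁅π u, π v⁆ ^ l := by
      intro l
      induction l with
      | zero => simp
      | succ l ih => rw [pow_succ, hLmul (pow_mem hu l) hu hv, ih, pow_succ]
    rcases Int.eq_nat_or_neg k with ⟨l, rfl | rfl⟩
    · rw [zpow_natCast, zpow_natCast, hL]
    · rw [zpow_neg, zpow_natCast, zpow_neg, zpow_natCast, ← hL]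
      have h1 := hLmul (inv_mem (pow_mem hu l)) (pow_mem hu l) hv
      rw [inv_mul_cancel, map_one, commutatorElement_one_left] at h1
      exact eq_inv_of_mul_eq_one_left h1.symm
  -- generators of the layer and the normal form
  set uE : SL(2, ℤ) := T ^ M with huE
  set uF : SL(2, ℤ) := S * uE * S⁻¹ with huF
  set uH : SL(2, ℤ) := T * uF * T⁻¹ with huH
  have mE : uE ∈ Gamma M := T_pow_mem_Gamma₃ M
  have mF : uF ∈ Gamma M := (Gamma_normal M).conj_mem _ mE S
  have mH : uH ∈ Gamma M := (Gamma_normal M).conj_mem _ mF T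
  have t00 : ((T : SL(2, ℤ)) 0 0 : ℤ) = 1 := by simp [coe_T]
  have t01 : ((T : SL(2, ℤ)) 0 1 : ℤ) = 1 := by simp [coe_T]
  have t10 : ((T : SL(2, ℤ)) 1 0 : ℤ) = 0 := by simp [coe_T]
  have t11 : ((T : SL(2, ℤ)) 1 1 : ℤ) = 1 := by simp [coe_T]
  obtain ⟨Φ, -, -, -, P4, P5, P6, P7⟩ := exists_layerCoord_mul M 2 hM hM2
  have ΦE : Φ ⟨uE, mE⟩ = Multiplicative.ofAdd (0, 1, 0) := P5 mE
  have ΦF : Φ ⟨uF, mF⟩ = Multiplicative.ofAdd (0, 0, -1) := P6 mF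
  have ΦH : Φ ⟨uH, mH⟩ = Multiplicative.ofAdd (-1, 1, -1) := by
    have h4 := P4 T uF mF mH 0 0 (-1) ΦF
    rw [t00, t01, t10, t11] at h4
    push_cast at h4
    exact h4.trans (congrArg _ (by decide))
  have hNF : ∀ u ∈ Gamma M, ∃ (i k l : ℤ) (γ : SL(2, ℤ)), γ ∈ Gamma (M * 2) ∧
      u = γ * (uH ^ i * uE ^ k * uF ^ l) := by
    intro u hu
    obtain ⟨i, k, l, hmem⟩ := P7 uH uE uF mH mE mF ΦH ΦE ΦF u hu
    exact ⟨i, k, l, u * (uH ^ i * uE ^ k * uF ^ l)⁻¹, hmem, by group⟩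
  -- `c₀ = [ê, f̂] = 1`
  have hc0 : ⁅π uE, π uF⁆ = 1 := by
    rw [← map_commutatorElement]
    exact hπone' _ (hcommN mE mF) hω
  -- `[ê, ·]` kills the layer
  have hE1 : ∀ v ∈ Gamma M, ⁅π uE, π v⁆ = 1 := by
    intro v hv
    obtain ⟨i, k, l, γ, hγ, hveq⟩ := hNF v hv
    have hγ' : γ ∈ Gamma M := hNA hγ
    have m1 : uH ^ i ∈ Gamma M := zpow_mem mH i
    have m2 : uE ^ k ∈ Gamma M := zpow_mem mE k
    have m3 : uF ^ l ∈ Gamma M := zpow_mem mF l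
    have vE : ⁅π uE, π uE⁆ = 1 := commutatorElement_self _
    have vH : ⁅π uE, π uH⁆ = 1 := by
      calc ⁅π uE, π uH⁆ = π T * ⁅π (T⁻¹ * uE * T), π uF⁆ * (π T)⁻¹ := by
            rw [huH]; simp only [map_mul, map_inv, commutatorElement_def]; group
        _ = π T * ⁅π uE, π uF⁆ * (π T)⁻¹ := by
            rw [show T⁻¹ * uE * T = uE by
              rw [huE, ((Commute.refl T).inv_left.pow_right M).eq, inv_mul_cancel_right]]
        _ = 1 := by rw [hc0, mul_one, mul_inv_cancel]
    rw [hveq, hRmul mE hγ' (mul_mem (mul_mem m1 m2) m3), (hcentralN γ hγ _).1, one_mul,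
      hRmul mE (mul_mem m1 m2) m3, hRmul mE m1 m2, hRzpow mE mH i, hRzpow mE mE k, hRzpow mE mF l, vH, vE,
      hc0, one_zpow, one_zpow, one_zpow, mul_one, mul_one]
  have hF1 : ∀ v ∈ Gamma M, ⁅π uF, π v⁆ = 1 := by
    intro v hv
    have hSv : S⁻¹ * v * S ∈ Gamma M := by simpa using (Gamma_normal M).conj_mem v hv S⁻¹
    calc ⁅π uF, π v⁆ = π S * ⁅π uE, π (S⁻¹ * v * S)⁆ * (π S)⁻¹ := by
          rw [huF]; simp only [map_mul, map_inv, commutatorElement_def]; group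
      _ = 1 := by rw [hE1 _ hSv, mul_one, mul_inv_cancel]
  have hH1 : ∀ v ∈ Gamma M, ⁅π uH, π v⁆ = 1 := by
    intro v hv
    have hTv : T⁻¹ * v * T ∈ Gamma M := by simpa using (Gamma_normal M).conj_mem v hv T⁻¹
    calc ⁅π uH, π v⁆ = π T * ⁅π uF, π (T⁻¹ * v * T)⁆ * (π T)⁻¹ := by
          rw [huH]; simp only [map_mul, map_inv, commutatorElement_def]; group
      _ = 1 := by rw [hF1 _ hTv, mul_one, mul_inv_cancel]
  -- conclusion by the normal form of `x`
  obtain ⟨i, k, l, γ, hγ, hxeq⟩ := hNF x hx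
  have m1 : uH ^ i ∈ Gamma M := zpow_mem mH i
  have m2 : uE ^ k ∈ Gamma M := zpow_mem mE k
  have m3 : uF ^ l ∈ Gamma M := zpow_mem mF l
  have hfinal : ⁅π x, π y⁆ = 1 := by
    rw [hxeq, hLmul (hNA hγ) (mul_mem (mul_mem m1 m2) m3) hy, (hcentralN γ hγ _).2, one_mul,
      hLmul (mul_mem m1 m2) m3 hy, hLmul m1 m2 hy, hLzpow mH hy i, hLzpow mE hy k, hLzpow mF hy l,
      hH1 y hy, hE1 y hy, hF1 y hy, one_zpow, one_zpow, one_zpow, mul_one, mul_one]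
  apply hπone
  rw [map_commutatorElement, hfinal]

/-- **For `4 ∣ M`, `θ` kills `ω₀ = [T^M, S T^M S⁻¹]`**: `T^M = A²` with `A = T^{M/2}`, and
`θ([A², f]) = θ([A, f])² = θ([A, f²]) = 1` since `[A, f] ∈ Γ(2M)` is central and `f² ∈ Γ(2M)`.
[cite: CalegariDimitrovTang2025, Corollary 4.5.3] [cite: Beyl1986, Theorem] -/
theorem map_omega_eq_one_of_four_dvd {M : ℕ} (hM4 : 4 ∣ M) (θ : Gamma (M * 2) →* Q)
    (hθ : ∀ (g x : SL(2, ℤ)) (hx : x ∈ Gamma (M * 2)) (hgx : g * x * g⁻¹ ∈ Gamma (M * 2)),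
      θ ⟨g * x * g⁻¹, hgx⟩ = θ ⟨x, hx⟩)
    (h : ⁅T ^ M, S * T ^ M * S⁻¹⁆ ∈ Gamma (M * 2)) : θ ⟨⁅T ^ M, S * T ^ M * S⁻¹⁆, h⟩ = 1 := by
  obtain ⟨c, hc⟩ := hM4
  haveI := Gamma_normal (M * 2)
  haveI := Gamma_normal M
  set A : SL(2, ℤ) := T ^ (2 * c) with hA
  set f : SL(2, ℤ) := S * T ^ M * S⁻¹ with hf
  have hAM : A * A = T ^ M := by rw [hA, ← pow_add, hc]; ring_nf
  have mA : A ∈ Gamma (2 * c) := T_pow_mem_Gamma₃ _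
  have mf : f ∈ Gamma M := (Gamma_normal M).conj_mem _ (T_pow_mem_Gamma₃ M) S
  -- `[A, f] ∈ Γ(2M)` since `2c · M` is a multiple of `2M`
  have hAf : ⁅A, f⁆ ∈ Gamma (M * 2) :=
    Gamma_le_Gamma_of_dvd₁₃ ⟨c, by rw [hc]; ring⟩ (commutatorElement_mem_Gamma_mul_of_mem mA mf)
  have hf2 : f * f ∈ Gamma (M * 2) := by
    rw [hf, show S * T ^ M * S⁻¹ * (S * T ^ M * S⁻¹) = S * (T ^ M * T ^ M) * S⁻¹ by group, ← pow_add,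
      ← mul_two]
    exact (Gamma_normal _).conj_mem _ (T_pow_mem_Gamma₃ _) S
  have h1 : ⁅A * A, f⁆ = A * ⁅A, f⁆ * A⁻¹ * ⁅A, f⁆ := by simp only [commutatorElement_def]; group
  have h2 : ⁅A, f * f⁆ = ⁅A, f⁆ * (f * ⁅A, f⁆ * f⁻¹) := by simp only [commutatorElement_def]; group
  have hAfc : A * ⁅A, f⁆ * A⁻¹ ∈ Gamma (M * 2) := (Gamma_normal _).conj_mem _ hAf A
  have hffc : f * ⁅A, f⁆ * f⁻¹ ∈ Gamma (M * 2) := (Gamma_normal _).conj_mem _ hAf f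
  have hAf2 : ⁅A, f * f⁆ ∈ Gamma (M * 2) := by rw [h2]; exact mul_mem hAf hffc
  have e1 : θ ⟨⁅T ^ M, S * T ^ M * S⁻¹⁆, h⟩ = θ ⟨⁅A, f⁆, hAf⟩ * θ ⟨⁅A, f⁆, hAf⟩ := by
    have hval : ⁅T ^ M, f⁆ = A * ⁅A, f⁆ * A⁻¹ * ⁅A, f⁆ := by rw [← hAM]; exact h1
    have : (⟨⁅T ^ M, S * T ^ M * S⁻¹⁆, h⟩ : Gamma (M * 2)) =
        ⟨A * ⁅A, f⁆ * A⁻¹, hAfc⟩ * ⟨⁅A, f⁆, hAf⟩ := Subtype.ext hval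
    rw [this, map_mul, hθ A _ hAf hAfc]
  have e2 : θ ⟨⁅A, f * f⁆, hAf2⟩ = θ ⟨⁅A, f⁆, hAf⟩ * θ ⟨⁅A, f⁆, hAf⟩ := by
    have : (⟨⁅A, f * f⁆, hAf2⟩ : Gamma (M * 2)) = ⟨⁅A, f⁆, hAf⟩ * ⟨f * ⁅A, f⁆ * f⁻¹, hffc⟩ :=
      Subtype.ext h2
    rw [this, map_mul, hθ f _ hAf hffc]
  have e3 : θ ⟨⁅A, f * f⁆, hAf2⟩ = 1 := by
    have hc1 : A * (f * f) * A⁻¹ ∈ Gamma (M * 2) := (Gamma_normal _).conj_mem _ hf2 A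
    have hval : ⁅A, f * f⁆ = A * (f * f) * A⁻¹ * (f * f)⁻¹ := commutatorElement_def A (f * f)
    have : (⟨⁅A, f * f⁆, hAf2⟩ : Gamma (M * 2)) = ⟨A * (f * f) * A⁻¹, hc1⟩ * ⟨f * f, hf2⟩⁻¹ :=
      Subtype.ext hval
    rw [this, map_mul, map_inv, hθ A _ hf2 hc1, mul_inv_cancel]
  rw [e1, ← e2, e3]

end UnboundedDenominators

end Literature.NumberTheory.Automorphic
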